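import Mathlib
import Summits.CriticalPhenomena.CardyFormulaZ2.Theorems.CardySelfRefinementDefs
import Summits.CriticalPhenomena.CardyFormulaZ2.Theorems.CardySelfRefinementRussoDriftPolynomial
import Literature.Probability.Percolation.PivotalCell
import Literature.Probability.Percolation.ProdBernoulliRusso
import Literature.Probability.Percolation.FourArmGarbanShift
import Summits.CriticalPhenomena.CardyFormulaZ2.Theorems.CardySelfRefinementTrivialSectorRateStubRussoOrbit
import Summits.CriticalPhenomena.CardyFormulaZ2.Theorems.CardySelfRefinementTrivialSectorRateStubPivotalMassSummation
import Summits.CriticalPhenomena.CardyFormulaZ2.Theorems.CardySelfRefinementTrivialSectorRateStubPivotalMassRelevance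
import Summits.CriticalPhenomena.CardyFormulaZ2.Theorems.CardySelfRefinementTrivialSectorRateStubSixArmSectorMassCorrected
import Summits.CriticalPhenomena.CardyFormulaZ2.Theorems.CardySelfRefinementTrivialSectorRateStubFarFieldFactorisation
import Summits.CriticalPhenomena.CardyFormulaZ2.Theorems.CardySelfRefinementTrivialSectorRateStubOrbitAlignmentConditioning
import Summits.CriticalPhenomena.CardyFormulaZ2.Theorems.CardySelfRefinementTrivialSectorRateStubFourArmAboveOneExplorerAssembly
import Summits.CriticalPhenomena.CardyFormulaZ2.Theorems.CardySelfRefinementTrivialSectorRateStubSixArmSectorMassKMultiple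
import HarnessLib

/-!
# Line `far-field-is-a-quarter-turn` for the crux `CardySelfRefinement.TrivialSectorRate`
# (stmt-CriticalPhenomena-10266) — proof SKELETON, reshape r5 (continuation lead c2, cycle 3;
# re-registered unchanged by continuation leads c4, cycle 4, c5, cycle 5, and c6, cycle 6)

Planner `planner-cruxplan-stmt-CriticalPhenomena-10266-far-field-is-a-quart-0` (r1), lead
`prover-line-stmt-CriticalPhenomena-10266-0` (r2), continuation leads
`prover-line-stmt-CriticalPhenomena-10266-c1-0` (r3, r4), `…-c2-0` (r5), `…-c4-0` (r5, cycle 4), `…-c5-0`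
(r5, cycle 5) and `…-c6-0` (r5, cycle 6), 2026-08-16/17; route
`CardySelfRefinement`, sub-problem `CriticalPhenomena/CardyFormulaZ2`.  Informal statements, sizes, sources,
barriers and the Disproof/triage bookkeeping: line card `Lines/far-field-is-a-quarter-turn.md`.  Vocabulary
`ax tb opn cfg prm M A P Dρ Dc PathOK window Aloc` and the sub-namespace `FarField`
(`Coin coinEvent coinLaw infl ctr bundlesAt cellsAt interiorEdges Tρ Tc Piv quadBdry bdist
sixArmThreeClustersAt boxEdgesAt Rel Six farScale wt FourArmAboveOneAlong SixArmDecayAlong`) from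
`Theorems/CardySelfRefinementDefs` (definitionally the route's `let`-chain; `trivialSectorRate_iff` is
`Iff.rfl`).

THE CRUX.  Along every RSW path `γ` of the self-refinement model `M_k(ρ,c)` (`k = 2, 3`) and for every
finite quad family `F`: `∃ θ > 0`, a continuous nonvanishing `η`-independent direction field
`(κ₁, κ₂)(s)` and `C, η₀` with `|κ₂(s) ∂ρP − κ₁(s) ∂cP| ≤ C η^θ` for all `s` and `η < η₀`.

THE LINE (idea card `far-field-is-a-quarter-turn`, merged with `six-minus-five`).  Currency: COIN
INFLUENCES grouped in `C₄`-ORBITS about coarse vertices `u`: `Tρ(u)`, `Tc(u)` (orbit-grouped responses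
of the selector coins of the four bundles at `u` / of the own coins of the interior edges of the four
cells at `u`), `Piv(u)` the same sums with absolute values, `bdist(u)` the plane distance from the drawn
block centre to the quad boundaries, `Rel u R` = the lattice `R`-box about `k•u` is pivotal as a set.

* `stub_russoOrbit` (PROVED, p98986) — `∂ρP = Σ_u Tρ(u)`, `∂cP = Σ_u Tc(u)`.
* `stub_blockAlignment` — THE ENGINE, registered (r5) in its WEAKEST SUFFICIENT FORM (the bet; open):
  there are a continuous nonvanishing direction field `κ(s)` and `C, R₀` such that every block whose
  lattice `R`-box (`R ≥ R₀`, `k ∣ R`) stays below its far field (`4ηR < bdist u`) satisfies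
  `|κ₂(s) Tρ(u) − κ₁(s) Tc(u)| ≤ C/R · M_k(γ s)(Rel u k)`,
  uniformly in `s`, `η`, the quad family, the block.  This is exactly what the per-block summation
  consumes.  Physics (Disproof.lean §4, card): after the `C₄`-orbit sum every `C₄`-charged correction to
  the four-arm-conditioned near-field law (spin-1 states at `23/16`, the spin-2 stress-tensor doublet at
  gap `3/4`, spin 3) cancels; the surviving `C₄`-trivial corrections have gaps `5/3` (six legs, spin 0),
  `2` (descendants), `3` (spin 4), so the predicted rate is `R^{-5/3}` and the registered `R^{-1}` has
  margin `2/3` — with or without splitting off the six-arm sector.  Hence r5 FOLDS THE SIX-ARM SECTOR INTO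
  THE ENGINE: r4's second error term `C · Six(u, R)` and the stub `stub_sixArmDecay` that paid for its
  summation (six-arm exponent `2 + ε` for `M_k` = five-arm upper bound + sixth-arm price = the full
  arm-separation toolkit for `M_k`, j ≤ 6; cf. ≈ 100 tree files for j = 2 on site-𝕋) LEAVE THE LINE at
  no cost in plausibility.  (r4's split engine + `SixArmDecayAlong` + `sixArmSectorMass_kMultiple`
  (p122340) remain a proved alternative route in the tree history, commit ebe1264f0f3e.)
* `LocalEngine` (NOT a stub; a documented SUFFICIENT condition with PROVED glue
  `blockAlignment_of_localEngine`): the far-field-CONDITIONED form — for EVERY outside coin configuration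
  `S` (coins off the coin window `K_R` of the `R`-box frozen, coins in `K_R` resampled with law
  `ν = coinLaw.map (· ∩ K_R)`) the CONDITIONAL orbit sums align,
  `|κ₂ Tρ_S(u) − κ₁ Tc_S(u)| ≤ C/R · ν{k-box relevant | S}` — the Garban–Pete–Schramm "coupling of the
  near field uniformly in the faces" statement with explicit rate `1` after `C₄`-averaging, `η`-free and
  `F`-blind; the form a proof is expected to deliver.  Averaging over `S` (Fubini on the coin product,
  `prodBernoulli_real_eq_integral_cond`, p117372) gives `BlockAlignment`.
* `stub_fourArmAboveOne` (PROVED, p123868) — `x₄ > 1` uniformly along the path (Garban's scheme for `M_k`).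
* `stub_boundaryRelevance` — (HB) boundary relevance above one for every finite quad family (two-scale
  reduction + polygonal counts PROVED p117763/p117840/p117877; open: boundary three-arm exponent `> 1`
  (two-arm counting gives `1`; the extra closed arm must be priced by an exploration/RSW argument for
  `M_k`) + corner bound (one-arm decay in sectors, RSW); ARBITRARY topological quads additionally need a
  Beurling-type percolation estimate — the quad-regularity risk of the crux as typed).
* mass theorems (PROVED): `weightedRelevanceMass_of_factorisation` (p117313: (H4)+(HB)+(HT) ⇒
  `Σ_u wt(u) M(Rel u k) = O(η^a)`), `stub_farFieldFactorisation` (p114970, (HT)).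

`TrivialSectorRate_of` composes the registered stubs (two OPEN: block alignment = the engine, boundary
relevance; `stub_russoOrbit`, `stub_fourArmAboveOne`, `stub_farFieldFactorisation` PROVED) into the crux
BY NAME with no `sorry`: per block (`perBlockR`: far blocks by the engine at `R = k⌊farScale u/k⌋₊`,
contact blocks by `|Tρ| + |Tc| ≤ Piv ≤ (2+2k²) M(Rel u k)`), summed over the Russo–orbit set against the
weighted relevance mass; `θ = a`.

Disproof used: `Cruxes/TrivialSectorRate/Disproof.lean` v5 (tree): no `_false_without_` theorem, no
`Negative/` lemma (nothing to import); its MC CONFIRMS the engine's `s = 1` prediction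
(`Dρ/Dc − κ ∝ n^{-1.72}`, θ ≈ 0.95, θ₀ ≈ 1.7 ≥ 5/3); its §4 sector table (4-leg sector
`F_{2,1} ⊕ F_{2,−1}`: spins 1, 2, 3 charged under `C₄`, first `C₄`-trivial gaps 5/3, 2, 3) is the reason the
six-arm split is unnecessary; its warning that seed-by-seed TV couplings are capped at the spin-2 gap 3/4
is honoured: the engine is stated for `C₄`-ORBIT SUMS only.
-/

noncomputable section

open scoped Classical BigOperators

namespace Summit.CriticalPhenomena.CardyFormulaZ2.Cruxes.TrivialSectorRate.FarFieldIsAQuarterTurn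

open Set MeasureTheory Filter
open Literature.Probability.LatticeModels Literature.Probability.Percolation
open Literature.Probability.Percolation.QuadCrossing
open Summit.CriticalPhenomena.CardyFormulaZ2.Theses.CardySelfRefinement
open Summit.CriticalPhenomena.CardyFormulaZ2.Theorems.CardySelfRefinement
open Summit.CriticalPhenomena.CardyFormulaZ2.Theorems.CardySelfRefinement.FarField

/-! ## §1 Vocabulary: the sub-namespace `FarField` of `Theorems/CardySelfRefinementDefs.lean` (tree, p96573). -/

/-! ## §2 The stub STATEMENTS (named `Prop`s) — reshape r5

Reshape r3 (c1, after wave 1 of cycle 2): the r2 engine `stub_orbitAlignment`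
(`|κ₂Tρ − κ₁Tc| ≤ C/R·Piv + C·Six`) was replaced by the far-field-conditioned `stub_localEngine` plus proved
glue and the proved relevance-normalised mass theorem.  Reshape r4 (c1, after wave 3):
`stub_fourArmAboveOne` PROVED (p123868); engine radii in `kℕ`.  Reshape r5 (c2, cycle 3): the six-arm
sector is folded into the engine (physically free, see the module docstring), `stub_sixArmDecay` retired,
and the engine is registered in its weakest sufficient, `S`-averaged form `stub_blockAlignment`; the
conditioned `LocalEngine` stays as a sufficient condition with proved glue.  Open registered stubs:
`stub_blockAlignment`, `stub_boundaryRelevance`. -/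

/-- STUB 1 statement — **RUSSO–ORBIT DECOMPOSITION** (PROVED, p98986). -/
def RussoOrbit : Prop :=
  ∀ k : ℕ, k = 2 ∨ k = 3 → ∀ q : ℝ × ℝ, q ∈ Set.Icc (0 : ℝ) 1 ×ˢ Set.Icc (0 : ℝ) 1 → ∀ η : ℝ, 0 < η →
    ∀ (m : ℕ) (F : Fin m → Quad (univ : Set ℂ)), ∃ U : Finset (Site 2),
      Dρ k m F η q = ∑ u ∈ U, Tρ k m F η q u ∧ Dc k m F η q = ∑ u ∈ U, Tc k m F η q u

/-- **THE LOCAL (far-field-conditioned) ENGINE** — r5: NOT a registered stub but a documented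
sufficient condition for `BlockAlignment` (glue `blockAlignment_of_localEngine` below).  Along every RSW
path there are a CONTINUOUS, nonvanishing, `η`- and `F`-independent direction field `(κ₁, κ₂)(s)` and
constants `C ≥ 0`, `R₀ ≥ 1` such that for every block `u` whose lattice `R`-box (`R ≥ R₀`, `k ∣ R`) stays
below its far field (`4ηR < bdist u`) and for EVERY coin configuration `S` — read only OFF the coin
window `K := coinWindow k (boxEdgesAt (k•u) R)` of the `R`-box; the coins in `K` are resampled with law
`ν := (coinLaw k (γ s)).map (· ∩ K)`; written as a β-redex `(fun K ν => …) K ν` — the CONDITIONAL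
orbit-grouped responses satisfy `|κ₂ Tρ_S − κ₁ Tc_S| ≤ C/R · ν{k-box relevant | S}`: the `C₄`-orbit sums
forget the boundary condition at relative rate `1/R` (predicted `5/3`; six-arm sector included). -/
def LocalEngine : Prop :=
  ∀ k : ℕ, k = 2 ∨ k = 3 → ∀ γ : unitInterval → ℝ × ℝ, PathOK k γ →
    ∃ κ₁ κ₂ : unitInterval → ℝ, Continuous κ₁ ∧ Continuous κ₂ ∧ (∀ s, κ₁ s ≠ 0 ∨ κ₂ s ≠ 0) ∧
      ∃ (C : ℝ) (R₀ : ℕ), 0 ≤ C ∧ 1 ≤ R₀ ∧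
        ∀ (s : unitInterval) (η : ℝ), 0 < η → ∀ (m : ℕ) (F : Fin m → Quad (univ : Set ℂ))
          (u : Site 2) (R : ℕ), R₀ ≤ R → k ∣ R → 4 * η * R < bdist k m F η u → ∀ S : Set Coin,
          (fun (K : Set Coin) (ν : Measure (Set Coin)) =>
            |κ₂ s * ((1 / 2 : ℝ) * ∑ b ∈ bundlesAt u,
                (ν.real {T | insert (b.1, b.2, (2 : Fin 3)) (T ∪ (S \ K)) ∈ coinEvent k m F η} -
                  ν.real {T | (T ∪ (S \ K)) \ {(b.1, b.2, (2 : Fin 3))} ∈ coinEvent k m F η})) -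
              κ₁ s * ((1 / 4 : ℝ) * ∑ t ∈ cellsAt u, ∑ e ∈ interiorEdges k t,
                (ν.real {T | insert (e.1, e.2, (0 : Fin 3)) (T ∪ (S \ K)) ∈ coinEvent k m F η} -
                  ν.real {T | (T ∪ (S \ K)) \ {(e.1, e.2, (0 : Fin 3))} ∈ coinEvent k m F η}))| ≤
              C / R * ν.real {T | cfg k (T ∪ (S \ K)) ∈ Rel k m F η u k})
            (coinWindow k (boxEdgesAt (ctr k u) R))
            ((coinLaw k (γ s)).map (fun T => T ∩ coinWindow k (boxEdgesAt (ctr k u) R)))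

/-- STUB 2‴ statement — **BLOCK ALIGNMENT** (the ENGINE, registered r5 in its weakest sufficient,
`S`-averaged, relevance-normalised form; open — the bet of the line, the isolated open problem):
along every RSW path there are a CONTINUOUS, nonvanishing, `η`- and `F`-independent direction field
`(κ₁, κ₂)(s)` and constants `C ≥ 0`, `R₀ ≥ 1` such that every block `u` whose lattice `R`-box (`R ≥ R₀`,
`k ∣ R`) stays below its far field (`4ηR < bdist u`) satisfies
`|κ₂(s) Tρ(u) − κ₁(s) Tc(u)| ≤ C/R · M_k(γ s)(Rel u k)`. -/
def BlockAlignment : Prop :=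
  ∀ k : ℕ, k = 2 ∨ k = 3 → ∀ γ : unitInterval → ℝ × ℝ, PathOK k γ →
    ∃ κ₁ κ₂ : unitInterval → ℝ, Continuous κ₁ ∧ Continuous κ₂ ∧ (∀ s, κ₁ s ≠ 0 ∨ κ₂ s ≠ 0) ∧
      ∃ (C : ℝ) (R₀ : ℕ), 0 ≤ C ∧ 1 ≤ R₀ ∧
        ∀ (s : unitInterval) (η : ℝ), 0 < η → ∀ (m : ℕ) (F : Fin m → Quad (univ : Set ℂ))
          (u : Site 2) (R : ℕ), R₀ ≤ R → k ∣ R → 4 * η * R < bdist k m F η u →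
          |κ₂ s * Tρ k m F η (γ s) u - κ₁ s * Tc k m F η (γ s) u| ≤
            C / R * (M k (γ s).1 (γ s).2).real (Rel k m F η u k)

/-- STUB 3 statement — **FOUR ARMS DECAY FASTER THAN `1/R`, UNIFORMLY ALONG THE PATH** (`x₄ > 1`). -/
def FourArmAboveOne : Prop :=
  ∀ k : ℕ, k = 2 ∨ k = 3 → ∀ γ : unitInterval → ℝ × ℝ, PathOK k γ → FourArmAboveOneAlong k γ

/-- STUB 4′ statement — **BOUNDARY RELEVANCE ABOVE ONE** (hypothesis (HB) of both mass theorems,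
verbatim).  RISK: `Quad` is an ARBITRARY topological square; for fractal / positive-area boundaries no
proof route exists (reductions landed for POLYGONAL families: `boundaryRelevance_of_small_scales`,
`boundaryRelevance_small_of_twoScale`, `twoScaleCount_of_polygonal`). -/
def BoundaryRelevance : Prop :=
  ∀ k : ℕ, k = 2 ∨ k = 3 → ∀ γ : unitInterval → ℝ × ℝ, PathOK k γ →
    ∀ (m : ℕ) (F : Fin m → Quad (univ : Set ℂ)),
      ∃ b C₀ η₀ : ℝ, 0 < b ∧ 0 < η₀ ∧ ∀ (s : unitInterval), ∀ η ∈ Set.Ioo (0 : ℝ) η₀, ∀ (D : ℕ), 1 ≤ D →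
        ∀ U : Finset (Site 2),
          ∑ u ∈ U.filter (fun u => bdist k m F η u < 2 * D * η),
            (M k (γ s).1 (γ s).2).real (Rel k m F η u D) ≤ C₀ * (D : ℝ) ^ 2 * min 1 (((D : ℝ) * η) ^ b)

/-- STUB 6′ statement — **FAR-FIELD FACTORISATION OF BLOCK RELEVANCE** (hypothesis (HT), PROVED p114970). -/
def FarFieldFactorisation : Prop :=
  ∀ k : ℕ, k = 2 ∨ k = 3 → ∀ γ : unitInterval → ℝ × ℝ, ∀ (m : ℕ) (F : Fin m → Quad (univ : Set ℂ)),
    ∃ (C₁ : ℝ) (r₁ R₁ : ℕ), 1 ≤ r₁ ∧ ∀ (s : unitInterval) (η : ℝ), 0 < η → ∀ (u : Site 2) (R : ℕ),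
      R₁ ≤ R → 4 * η * R < bdist k m F η u →
        (M k (γ s).1 (γ s).2).real (Rel k m F η u k) ≤
          C₁ * (M k (γ s).1 (γ s).2).real (fourArmTwoClustersAt (ctr k u) r₁ R) *
            (M k (γ s).1 (γ s).2).real (Rel k m F η u (2 * R))

/-! ## §3 The registered stubs (`sorry` lives only in the open ones) -/

/-- **STUB 1 · `stub_russoOrbit`** — PROVED: the tree theorem `FarField.stub_russoOrbit` (p98986). -/
theorem stub_russoOrbit :
    ∀ k : ℕ, k = 2 ∨ k = 3 → ∀ q : ℝ × ℝ, q ∈ Set.Icc (0 : ℝ) 1 ×ˢ Set.Icc (0 : ℝ) 1 → ∀ η : ℝ, 0 < η →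
      ∀ (m : ℕ) (F : Fin m → Quad (univ : Set ℂ)), ∃ U : Finset (Site 2),
        Dρ k m F η q = ∑ u ∈ U, Tρ k m F η q u ∧ Dc k m F η q = ∑ u ∈ U, Tc k m F η q u :=
  FarField.stub_russoOrbit

/-- **STUB 2‴ · `stub_blockAlignment`** (size XL; OPEN — the load-bearing bet of the line, held by the
lead; `BlockAlignment` verbatim).  Proof plan (card `far-field-is-a-quarter-turn`, GPS13 §3–5 template
turned linear): prove the conditioned `LocalEngine` — for a fixed boundary condition `S` the inside event
is a function of the connectivity pattern the `R`-box induces among the boundary clusters; a block coin is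
pivotal only through `≥ 4` alternating arms from the ring `k+1` to `R`; the conditional response of each
seed is (near-field law given the four-arm connection to the pattern required by `S`) × (seed score); the
`C₄(u)`-ORBIT sums see only the `C₄`-average of that law, whose distance to the `C₄`-average of the
incipient four-arm law `P_∞(s)` must be `≤ C (k/R)^{1}` UNIFORMLY in `S` (bet; predicted `(k/R)^{5/3}`:
all `C₄`-charged channels cancel in the orbit sum, Disproof.lean §4); `κ(s) :=` the `P_∞(s)`-amplitudes
of the two seed classes, continuous in `s` by continuity of the incipient law along the path;
`κ₂(0) = 0` is allowed (dangling interior edges at `c = 0`).  Then average over `S`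
(`blockAlignment_of_localEngine`).  No quantified coupling rate exists in print even for Bernoulli
percolation (GPS13, arXiv:1008.1378 §5: "some k > 0"); a TV coupling cannot exceed the spin-2 gap 3/4, so
the proof must be an eigen-expansion of the four-arm annulus transfer with the `C₄`-trivial projection
applied before absolute values. -/
theorem stub_blockAlignment :
    ∀ k : ℕ, k = 2 ∨ k = 3 → ∀ γ : unitInterval → ℝ × ℝ, PathOK k γ →
      ∃ κ₁ κ₂ : unitInterval → ℝ, Continuous κ₁ ∧ Continuous κ₂ ∧ (∀ s, κ₁ s ≠ 0 ∨ κ₂ s ≠ 0) ∧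
        ∃ (C : ℝ) (R₀ : ℕ), 0 ≤ C ∧ 1 ≤ R₀ ∧
          ∀ (s : unitInterval) (η : ℝ), 0 < η → ∀ (m : ℕ) (F : Fin m → Quad (univ : Set ℂ))
            (u : Site 2) (R : ℕ), R₀ ≤ R → k ∣ R → 4 * η * R < bdist k m F η u →
            |κ₂ s * Tρ k m F η (γ s) u - κ₁ s * Tc k m F η (γ s) u| ≤
              C / R * (M k (γ s).1 (γ s).2).real (Rel k m F η u k) := by
  sorry

/-- **STUB 3 · `stub_fourArmAboveOne`** — PROVED (wave 3 of cycle 2, p123868): the tree theorem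
`FarField.stub_fourArmAboveOne` (`Theorems/CardySelfRefinementTrivialSectorRateStubFourArmAboveOneExplorerAssembly.lean`:
Garban's scheme for `M_k` along the path — circuits p115934, two-arm decay p118185, second moment p121788,
circuit bits p120505, explorer/orthogonality p122845, centres p123065, scheme p123539, assembly p123868). -/
theorem stub_fourArmAboveOne :
    ∀ k : ℕ, k = 2 ∨ k = 3 → ∀ γ : unitInterval → ℝ × ℝ, PathOK k γ → FourArmAboveOneAlong k γ :=
  FarField.stub_fourArmAboveOne

/-- **STUB 4′ · `stub_boundaryRelevance`** (size XL; carries the quad-regularity risk; reductions for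
polygonal families PROVED p114812/p115544/p117763/p117840/p117877 — `boundaryRelevance_small_of_twoScale`
takes (count) [PROVED for polygonal families, `twoScaleCount_of_polygonal`], (corner) [PROVED for EVERY
family in cycle 3: `real_Rel_le_pow_along` p125884 — relevance of a `D`-box decays like `(Dη)^c` along
the path, from `exists_openWalk_of_mem_Rel` p125589 (a pivotal box sends an open walk to plane distance
half the side separation) and `openArm_decay_along` p125415 (primal one-arm decay along `γ`)], and
(two-scale) [OPEN: half-plane three-arm exponent `> 1` for `M_k` along `γ` at straight boundary pieces —
two-arm endpoint counting gives exactly `1`, the extra alternating arm must be priced (arm-separation /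
exploration technology for `M_k`)]; ARBITRARY topological quads additionally need a Beurling-type
estimate).  Cycle 4 (c4, `Cruxes/TrivialSectorRate/HBReimerObstructionMap.md`): of the four boundary
cases (free/wired side × `k = 2, 3`) the coin-space Reimer technology reaches exactly the FREE side at
`k = 2`, whose lattice estimates are LANDED — `twoArm_window_along` (p129206: docked half-plane two-arm
window bound for `M_k` along `γ`, exponent `1`, from the vertex-induced cluster tail p129062 and Werner
counting p129006), `threeArmFree_window_along` (p129971: the `k = 2` free-side ordered three-arm window
bound `≤ C (m/n)^{1+α}`, from the coin inclusion p129812, Reimer + one-arm decays p129777, opposite-state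
coin certificates p128619) and `longCrossing_decay_along` (p128767, strip/wander control); the WIRED
pattern (closed, open, closed) and the `k = 3` free pattern meet same-state pinches through one bundle
that no read-out certifies (needs exploration with bundle leakage / arm separation for `M_k`).
`BoundaryRelevance` verbatim. -/
theorem stub_boundaryRelevance :
    ∀ k : ℕ, k = 2 ∨ k = 3 → ∀ γ : unitInterval → ℝ × ℝ, PathOK k γ →
      ∀ (m : ℕ) (F : Fin m → Quad (univ : Set ℂ)),
        ∃ b C₀ η₀ : ℝ, 0 < b ∧ 0 < η₀ ∧ ∀ (s : unitInterval), ∀ η ∈ Set.Ioo (0 : ℝ) η₀, ∀ (D : ℕ), 1 ≤ D →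
          ∀ U : Finset (Site 2),
            ∑ u ∈ U.filter (fun u => bdist k m F η u < 2 * D * η),
              (M k (γ s).1 (γ s).2).real (Rel k m F η u D) ≤
                C₀ * (D : ℝ) ^ 2 * min 1 (((D : ℝ) * η) ^ b) := by
  sorry

/-- **STUB 6′ · `stub_farFieldFactorisation`** — PROVED: the tree theorem
`FarField.stub_farFieldFactorisation` (p114970). -/
theorem stub_farFieldFactorisation :
    ∀ k : ℕ, k = 2 ∨ k = 3 → ∀ γ : unitInterval → ℝ × ℝ, ∀ (m : ℕ) (F : Fin m → Quad (univ : Set ℂ)),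
      ∃ (C₁ : ℝ) (r₁ R₁ : ℕ), 1 ≤ r₁ ∧ ∀ (s : unitInterval) (η : ℝ), 0 < η → ∀ (u : Site 2) (R : ℕ),
        R₁ ≤ R → 4 * η * R < bdist k m F η u →
          (M k (γ s).1 (γ s).2).real (Rel k m F η u k) ≤
            C₁ * (M k (γ s).1 (γ s).2).real (fourArmTwoClustersAt (ctr k u) r₁ R) *
              (M k (γ s).1 (γ s).2).real (Rel k m F η u (2 * R)) :=
  FarField.stub_farFieldFactorisation

/-! ### Consistency: each named statement IS its registered stub (definitionally) -/

theorem russoOrbit_holds : RussoOrbit := stub_russoOrbit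
theorem blockAlignment_holds : BlockAlignment := stub_blockAlignment
theorem fourArmAboveOne_holds : FourArmAboveOne := stub_fourArmAboveOne
theorem boundaryRelevance_holds : BoundaryRelevance := stub_boundaryRelevance
theorem farFieldFactorisation_holds : FarFieldFactorisation := stub_farFieldFactorisation

/-! ## §4 Name-keyed aliases of the statements (the hypotheses of the composition) -/
namespace Registered

/-- Alias of `RussoOrbit`, keyed by the registered stub name (PROVED). -/
abbrev stub_russoOrbit : Prop := RussoOrbit
/-- Alias of `BlockAlignment` (the engine, r5). -/
abbrev stub_blockAlignment : Prop := BlockAlignment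
/-- Alias of `FourArmAboveOne`. -/
abbrev stub_fourArmAboveOne : Prop := FourArmAboveOne
/-- Alias of `BoundaryRelevance`. -/
abbrev stub_boundaryRelevance : Prop := BoundaryRelevance
/-- Alias of `FarFieldFactorisation`. -/
abbrev stub_farFieldFactorisation : Prop := FarFieldFactorisation

end Registered


/-! ## §5 The composition: the stubs imply the crux BY NAME (kernel-checked; no `sorry` below) -/

/-! ### §5a Glue: the local engine implies the averaged relevance-normalised engine (Fubini) -/

/-- `S ↦ insert i S` is measurable on `Set Coin`. -/
theorem measurable_insert_coin (i : Coin) : Measurable fun S : Set Coin => insert i S :=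
  measurable_set_iff.2 fun a => show Measurable fun S : Set Coin => a = i ∨ a ∈ S from
    measurable_const.or (measurable_set_mem a)

/-- `S ↦ S \ {i}` is measurable on `Set Coin`. -/
theorem measurable_erase_coin (i : Coin) : Measurable fun S : Set Coin => S \ {i} :=
  measurable_sdiff_right {i}

/-- **GLUE.**  The local (conditioned) engine implies the averaged relevance-normalised engine
`BlockAlignment`: integrate the conditional inequality over the boundary condition `S` (the signed
influence of a coin is the integral of its conditional influence, `prodBernoulli_real_eq_integral_cond`;
`|∫ f| ≤ ∫ |f|`; the conditional relevance probability integrates to `M(Rel u k)`). -/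
theorem blockAlignment_of_localEngine (hL : LocalEngine) : BlockAlignment := by
  intro k hk γ hγ
  obtain ⟨κ₁, κ₂, hκ₁, hκ₂, hnv, C, R₀, hC, hR₀, hloc⟩ := hL k hk γ hγ
  refine ⟨κ₁, κ₂, hκ₁, hκ₂, hnv, C, R₀, hC, hR₀, ?_⟩
  intro s η hη m F u R hR hkdvd hdist
  have hηne : η ≠ 0 := hη.ne'
  -- notation
  set K : Set Coin := coinWindow k (boxEdgesAt (ctr k u) R) with hK
  set p : Coin → unitInterval := prm k (γ s).1 (γ s).2 with hp
  set ν : Measure (Set Coin) := (coinLaw k (γ s)).map (fun T => T ∩ K) with hν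
  haveI : IsProbabilityMeasure ν :=
    Measure.isProbabilityMeasure_map (measurable_inter_right K).aemeasurable
  set E : Set (Set Coin) := coinEvent k m F η with hE
  have hEm : MeasurableSet E := (measurable_cfg k) (measurableSet_Aloc m F hηne)
  -- measurable events
  have hXp : ∀ i : Coin, MeasurableSet {S' : Set Coin | insert i S' ∈ E} := fun i =>
    measurable_insert_coin i hEm
  have hXm : ∀ i : Coin, MeasurableSet {S' : Set Coin | S' \ {i} ∈ E} := fun i =>
    measurable_erase_coin i hEm
  have hRelm : MeasurableSet ((cfg k) ⁻¹' Rel k m F η u k) :=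
    (measurable_cfg k) (measurableSet_Rel k m F hηne u k)
  -- conditional probabilities: measurable in `S`, bounded by `1`, hence integrable
  have hcp_meas : ∀ {X : Set (Set Coin)}, MeasurableSet X →
      Measurable fun S : Set Coin => ν.real {T | T ∪ (S \ K) ∈ X} := fun hX =>
    measurable_cond_real p K hX
  have hcp_int : ∀ {X : Set (Set Coin)}, MeasurableSet X →
      Integrable (fun S : Set Coin => ν.real {T | T ∪ (S \ K) ∈ X}) (coinLaw k (γ s)) := by
    intro X hX
    refine (integrable_const (1 : ℝ)).mono' (hcp_meas hX).aestronglyMeasurable (ae_of_all _ fun S => ?_)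
    rw [Real.norm_eq_abs, abs_of_nonneg measureReal_nonneg]
    exact measureReal_le_one
  have hcp_eq : ∀ {X : Set (Set Coin)}, MeasurableSet X →
      (coinLaw k (γ s)).real X = ∫ S, ν.real {T | T ∪ (S \ K) ∈ X} ∂(coinLaw k (γ s)) := fun hX =>
    prodBernoulli_real_eq_integral_cond p K hX
  -- integrability of the conditional influences (stated in the unfolded `setOf` form)
  have hIp : ∀ i : Coin, Integrable (fun S => ν.real {T | insert i (T ∪ (S \ K)) ∈ E})
      (coinLaw k (γ s)) := fun i => hcp_int (hXp i)
  have hIm : ∀ i : Coin, Integrable (fun S => ν.real {T | (T ∪ (S \ K)) \ {i} ∈ E})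
      (coinLaw k (γ s)) := fun i => hcp_int (hXm i)
  have hI : ∀ i : Coin, Integrable
      (fun S => ν.real {T | insert i (T ∪ (S \ K)) ∈ E} - ν.real {T | (T ∪ (S \ K)) \ {i} ∈ E})
      (coinLaw k (γ s)) := fun i => (hIp i).sub (hIm i)
  -- the conditional influence of a coin integrates to its influence
  have hinfl : ∀ i : Coin, infl k m F η (γ s) i =
      ∫ S, (ν.real {T | insert i (T ∪ (S \ K)) ∈ E} - ν.real {T | (T ∪ (S \ K)) \ {i} ∈ E})
        ∂(coinLaw k (γ s)) := by
    intro i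
    rw [integral_sub (hIp i) (hIm i)]
    show (coinLaw k (γ s)).real {S' | insert i S' ∈ E} - (coinLaw k (γ s)).real {S' | S' \ {i} ∈ E} = _
    rw [hcp_eq (hXp i), hcp_eq (hXm i)]
    rfl
  have hIρ : Integrable (fun S => (1 / 2 : ℝ) * ∑ b ∈ bundlesAt u,
      (ν.real {T | insert (b.1, b.2, (2 : Fin 3)) (T ∪ (S \ K)) ∈ E} -
        ν.real {T | (T ∪ (S \ K)) \ {(b.1, b.2, (2 : Fin 3))} ∈ E})) (coinLaw k (γ s)) :=
    (integrable_finsetSum _ fun b _ => hI _).const_mul _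
  have hIc : Integrable (fun S => (1 / 4 : ℝ) * ∑ t ∈ cellsAt u, ∑ e ∈ interiorEdges k t,
      (ν.real {T | insert (e.1, e.2, (0 : Fin 3)) (T ∪ (S \ K)) ∈ E} -
        ν.real {T | (T ∪ (S \ K)) \ {(e.1, e.2, (0 : Fin 3))} ∈ E})) (coinLaw k (γ s)) :=
    (integrable_finsetSum _ fun t _ => integrable_finsetSum _ fun e _ => hI _).const_mul _
  -- the orbit sums are integrals of the conditional orbit sums
  have hTρ : Tρ k m F η (γ s) u = ∫ S, (1 / 2 : ℝ) * ∑ b ∈ bundlesAt u,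
      (ν.real {T | insert (b.1, b.2, (2 : Fin 3)) (T ∪ (S \ K)) ∈ E} -
        ν.real {T | (T ∪ (S \ K)) \ {(b.1, b.2, (2 : Fin 3))} ∈ E}) ∂(coinLaw k (γ s)) := by
    rw [integral_const_mul, integral_finsetSum _ (fun b _ => hI _)]
    unfold Tρ
    congr 1
    exact Finset.sum_congr rfl fun b _ => hinfl _
  have hTc : Tc k m F η (γ s) u = ∫ S, (1 / 4 : ℝ) * ∑ t ∈ cellsAt u, ∑ e ∈ interiorEdges k t,
      (ν.real {T | insert (e.1, e.2, (0 : Fin 3)) (T ∪ (S \ K)) ∈ E} -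
        ν.real {T | (T ∪ (S \ K)) \ {(e.1, e.2, (0 : Fin 3))} ∈ E}) ∂(coinLaw k (γ s)) := by
    rw [integral_const_mul, integral_finsetSum _ (fun t _ => integrable_finsetSum _ fun e _ => hI _)]
    unfold Tc
    congr 1
    refine Finset.sum_congr rfl fun t _ => ?_
    rw [integral_finsetSum _ (fun e _ => hI _)]
    exact Finset.sum_congr rfl fun e _ => hinfl _
  have hLHS : κ₂ s * Tρ k m F η (γ s) u - κ₁ s * Tc k m F η (γ s) u =
      ∫ S, (κ₂ s * ((1 / 2 : ℝ) * ∑ b ∈ bundlesAt u,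
          (ν.real {T | insert (b.1, b.2, (2 : Fin 3)) (T ∪ (S \ K)) ∈ E} -
            ν.real {T | (T ∪ (S \ K)) \ {(b.1, b.2, (2 : Fin 3))} ∈ E})) -
        κ₁ s * ((1 / 4 : ℝ) * ∑ t ∈ cellsAt u, ∑ e ∈ interiorEdges k t,
          (ν.real {T | insert (e.1, e.2, (0 : Fin 3)) (T ∪ (S \ K)) ∈ E} -
            ν.real {T | (T ∪ (S \ K)) \ {(e.1, e.2, (0 : Fin 3))} ∈ E}))) ∂(coinLaw k (γ s)) := by
    rw [integral_sub (hIρ.const_mul _) (hIc.const_mul _), integral_const_mul (κ₂ s),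
      integral_const_mul (κ₁ s), hTρ, hTc]
  -- the pointwise bound from the local engine
  have key : ∀ S : Set Coin,
      |κ₂ s * ((1 / 2 : ℝ) * ∑ b ∈ bundlesAt u,
          (ν.real {T | insert (b.1, b.2, (2 : Fin 3)) (T ∪ (S \ K)) ∈ E} -
            ν.real {T | (T ∪ (S \ K)) \ {(b.1, b.2, (2 : Fin 3))} ∈ E})) -
        κ₁ s * ((1 / 4 : ℝ) * ∑ t ∈ cellsAt u, ∑ e ∈ interiorEdges k t,
          (ν.real {T | insert (e.1, e.2, (0 : Fin 3)) (T ∪ (S \ K)) ∈ E} -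
            ν.real {T | (T ∪ (S \ K)) \ {(e.1, e.2, (0 : Fin 3))} ∈ E}))| ≤
      C / R * ν.real {T | cfg k (T ∪ (S \ K)) ∈ Rel k m F η u k} := by
    intro S
    have h := hloc s η hη m F u R hR hkdvd hdist S
    dsimp only at h
    exact h
  -- integrability of the right-hand side (stated in the unfolded `preimage` form)
  have hIRel : Integrable (fun S : Set Coin => ν.real {T | cfg k (T ∪ (S \ K)) ∈ Rel k m F η u k})
      (coinLaw k (γ s)) := hcp_int hRelm
  have hIg : Integrable (fun S : Set Coin =>
      C / R * ν.real {T | cfg k (T ∪ (S \ K)) ∈ Rel k m F η u k}) (coinLaw k (γ s)) :=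
    hIRel.const_mul _
  have hRel_eq : ∫ S, ν.real {T | cfg k (T ∪ (S \ K)) ∈ Rel k m F η u k} ∂(coinLaw k (γ s)) =
      (M k (γ s).1 (γ s).2).real (Rel k m F η u k) := by
    rw [map_measureReal_apply (measurable_cfg k) (measurableSet_Rel k m F hηne u k)]
    exact (hcp_eq hRelm).symm
  -- integrate
  have hRHS : ∫ S, C / R * ν.real {T | cfg k (T ∪ (S \ K)) ∈ Rel k m F η u k} ∂(coinLaw k (γ s)) =
      C / R * (M k (γ s).1 (γ s).2).real (Rel k m F η u k) := by
    rw [integral_const_mul (C / R), hRel_eq]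
  calc |κ₂ s * Tρ k m F η (γ s) u - κ₁ s * Tc k m F η (γ s) u|
      = |∫ S, (κ₂ s * ((1 / 2 : ℝ) * ∑ b ∈ bundlesAt u,
            (ν.real {T | insert (b.1, b.2, (2 : Fin 3)) (T ∪ (S \ K)) ∈ E} -
              ν.real {T | (T ∪ (S \ K)) \ {(b.1, b.2, (2 : Fin 3))} ∈ E})) -
          κ₁ s * ((1 / 4 : ℝ) * ∑ t ∈ cellsAt u, ∑ e ∈ interiorEdges k t,
            (ν.real {T | insert (e.1, e.2, (0 : Fin 3)) (T ∪ (S \ K)) ∈ E} -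
              ν.real {T | (T ∪ (S \ K)) \ {(e.1, e.2, (0 : Fin 3))} ∈ E}))) ∂(coinLaw k (γ s))| := by
        rw [hLHS]
    _ ≤ ∫ S, |κ₂ s * ((1 / 2 : ℝ) * ∑ b ∈ bundlesAt u,
            (ν.real {T | insert (b.1, b.2, (2 : Fin 3)) (T ∪ (S \ K)) ∈ E} -
              ν.real {T | (T ∪ (S \ K)) \ {(b.1, b.2, (2 : Fin 3))} ∈ E})) -
          κ₁ s * ((1 / 4 : ℝ) * ∑ t ∈ cellsAt u, ∑ e ∈ interiorEdges k t,
            (ν.real {T | insert (e.1, e.2, (0 : Fin 3)) (T ∪ (S \ K)) ∈ E} -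
              ν.real {T | (T ∪ (S \ K)) \ {(e.1, e.2, (0 : Fin 3))} ∈ E}))| ∂(coinLaw k (γ s)) :=
        abs_integral_le_integral_abs
    _ ≤ ∫ S, C / R * ν.real {T | cfg k (T ∪ (S \ K)) ∈ Rel k m F η u k} ∂(coinLaw k (γ s)) :=
        integral_mono (((hIρ.const_mul _).sub (hIc.const_mul _)).abs) hIg key
    _ = C / R * (M k (γ s).1 (γ s).2).real (Rel k m F η u k) := hRHS

/-! ### §5b Per block -/

/-- `|Tρ u| + |Tc u| ≤ Piv u` (triangle inequality on the two orbit sums). -/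
theorem abs_Tρ_add_abs_Tc_le_Piv (k m : ℕ) (F : Fin m → Quad (univ : Set ℂ)) (η : ℝ) (q : ℝ × ℝ)
    (u : Site 2) : |Tρ k m F η q u| + |Tc k m F η q u| ≤ Piv k m F η q u := by
  unfold Tρ Tc Piv
  have h1 : |(1 / 2 : ℝ) * ∑ b ∈ bundlesAt u, infl k m F η q (b.1, b.2, (2 : Fin 3))| ≤
      (1 / 2 : ℝ) * ∑ b ∈ bundlesAt u, |infl k m F η q (b.1, b.2, (2 : Fin 3))| := by
    rw [abs_mul, abs_of_nonneg (by norm_num : (0 : ℝ) ≤ 1 / 2)]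
    exact mul_le_mul_of_nonneg_left (Finset.abs_sum_le_sum_abs _ _) (by norm_num)
  have h2 : |(1 / 4 : ℝ) * ∑ t ∈ cellsAt u, ∑ e ∈ interiorEdges k t, infl k m F η q (e.1, e.2, (0 : Fin 3))| ≤
      (1 / 4 : ℝ) * ∑ t ∈ cellsAt u, ∑ e ∈ interiorEdges k t, |infl k m F η q (e.1, e.2, (0 : Fin 3))| := by
    rw [abs_mul, abs_of_nonneg (by norm_num : (0 : ℝ) ≤ 1 / 4)]
    refine mul_le_mul_of_nonneg_left ?_ (by norm_num)
    refine (Finset.abs_sum_le_sum_abs _ _).trans ?_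
    exact Finset.sum_le_sum fun t _ => Finset.abs_sum_le_sum_abs _ _
  linarith

/-- The weight is nonnegative. -/
theorem wt_nonneg (k m : ℕ) (F : Fin m → Quad (univ : Set ℂ)) {η r : ℝ} (hη : 0 < η) (hr : 0 < r)
    (u : Site 2) : 0 ≤ wt k m F η r u := by
  unfold wt
  have : 0 < max (bdist k m F η u) (r * η) := lt_max_of_lt_right (by positivity)
  positivity

theorem wt_eq_one_of_le (k m : ℕ) (F : Fin m → Quad (univ : Set ℂ)) {η r : ℝ} (hη : 0 < η) (hr : 0 < r)
    {u : Site 2} (h : bdist k m F η u ≤ r * η) : wt k m F η r u = 1 := by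
  unfold wt
  rw [max_eq_right h]
  have : (0 : ℝ) < r * η := by positivity
  field_simp

theorem wt_eq_div_of_le (k m : ℕ) (F : Fin m → Quad (univ : Set ℂ)) {η r : ℝ}
    {u : Site 2} (h : r * η ≤ bdist k m F η u) : wt k m F η r u = r * η / bdist k m F η u := by
  unfold wt
  rw [max_eq_left h]

/-- **Per-block bound (relevance-normalised, radii in `kℕ`; r5: no six-arm term).**  With the engine
data `(κ, C_E, R₀)` and a bound `K` on `|κ₁|, |κ₂|`, every block satisfies
`|κ₂Tρ(u) − κ₁Tc(u)| ≤ (2K(2+2k²) + 2C_E/R₀) · wt(u) · M(Rel u k)` with the contact radius `r = 8kR₀`: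
far blocks (`R₀ ≤ farScale u / k`) by the engine at `R = k⌊farScale u / k⌋₊ ∈ kℕ`
(`C_E/R ≤ (2C_E/R₀)·wt u`), contact blocks by `|Tρ| + |Tc| ≤ Piv ≤ (2+2k²)M(Rel u k)` and `wt = 1`. -/
theorem perBlockR {k : ℕ} (hk : 0 < k) {γ : unitInterval → ℝ × ℝ} {κ₁ κ₂ : unitInterval → ℝ}
    {C K : ℝ} {R₀ : ℕ}
    (hC : 0 ≤ C) (hK : 0 ≤ K) (hK₁ : ∀ s, |κ₁ s| ≤ K) (hK₂ : ∀ s, |κ₂ s| ≤ K) (hR₀ : 1 ≤ R₀)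
    (hE : ∀ (s : unitInterval) (η : ℝ), 0 < η → ∀ (m : ℕ) (F : Fin m → Quad (univ : Set ℂ))
      (u : Site 2) (R : ℕ), R₀ ≤ R → k ∣ R → 4 * η * R < bdist k m F η u →
      |κ₂ s * Tρ k m F η (γ s) u - κ₁ s * Tc k m F η (γ s) u| ≤
        C / R * (M k (γ s).1 (γ s).2).real (Rel k m F η u k))
    (s : unitInterval) {η : ℝ} (hη : 0 < η) (m : ℕ) (F : Fin m → Quad (univ : Set ℂ)) (u : Site 2) :
    |κ₂ s * Tρ k m F η (γ s) u - κ₁ s * Tc k m F η (γ s) u| ≤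
      (2 * K * (2 + 2 * (k : ℝ) ^ 2) + 2 * C / R₀) *
        (wt k m F η (8 * k * R₀) u * (M k (γ s).1 (γ s).2).real (Rel k m F η u k)) := by
  have hR₀' : (1 : ℝ) ≤ R₀ := by exact_mod_cast hR₀
  have hR₀pos : (0 : ℝ) < R₀ := by linarith
  have hk1 : (1 : ℝ) ≤ k := by exact_mod_cast hk
  have hkpos : (0 : ℝ) < k := by linarith
  set Q := (M k (γ s).1 (γ s).2).real (Rel k m F η u k) with hQ
  have hQ0 : 0 ≤ Q := measureReal_nonneg
  have hPivQ : Piv k m F η (γ s) u ≤ (2 + 2 * (k : ℝ) ^ 2) * Q := Piv_le_real_Rel k m hk F η (γ s) u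
  have hr : (0 : ℝ) < 8 * k * R₀ := by positivity
  have hwt := wt_nonneg k m F (r := 8 * k * R₀) hη hr u
  set d := bdist k m F η u with hd
  have hk2 : (0 : ℝ) ≤ 2 + 2 * (k : ℝ) ^ 2 := by positivity
  -- `farScale = d / (8η)`; set `y := farScale / k`
  set y : ℝ := farScale k m F η u / k with hy
  have hyd : y = d / (8 * η * k) := by
    rw [hy, hd]; unfold farScale; rw [div_div]
  have hd_eq : d = 8 * η * k * y := by
    rw [hyd]; field_simp
  by_cases hfar : (R₀ : ℝ) ≤ y
  · -- far block: engine at `R = k ⌊y⌋₊`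
    have hy1 : (1 : ℝ) ≤ y := le_trans hR₀' hfar
    have hy0 : (0 : ℝ) ≤ y := by linarith
    set n : ℕ := ⌊y⌋₊ with hn
    have hnR₀ : R₀ ≤ n := Nat.le_floor hfar
    have hnle : (n : ℝ) ≤ y := Nat.floor_le hy0
    have hnlt : y < (n : ℝ) + 1 := Nat.lt_floor_add_one y
    have hn1 : (1 : ℝ) ≤ n := by exact_mod_cast (le_trans hR₀ hnR₀)
    have hnpos : (0 : ℝ) < n := by linarith
    set R : ℕ := k * n with hR
    have hRR₀ : R₀ ≤ R := le_trans hnR₀ (Nat.le_mul_of_pos_left n hk)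
    have hkR : k ∣ R := Dvd.intro n rfl
    have hRreal : (R : ℝ) = k * n := by rw [hR]; push_cast; ring
    have hdist : 4 * η * (R : ℝ) < bdist k m F η u := by
      rw [← hd, hd_eq, hRreal]
      have : 4 * η * ((k : ℝ) * n) ≤ 4 * η * (k * y) := by gcongr
      nlinarith [mul_pos (mul_pos hη hkpos) hnpos]
    have key := hE s η hη m F u R hRR₀ hkR hdist
    -- the weight on a far block
    have hdle : 8 * (k : ℝ) * R₀ * η ≤ d := by
      rw [hd_eq]; nlinarith [mul_pos (mul_pos hη hkpos) hR₀pos]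
    have hwt_eq : wt k m F η (8 * k * R₀) u = 8 * k * R₀ * η / d := by
      rw [hd]; exact wt_eq_div_of_le k m F (by rw [← hd]; exact hdle)
    -- `C / R ≤ (2C/R₀) · wt`
    have hcoef : C / (R : ℝ) ≤ (2 * C / R₀) * wt k m F η (8 * k * R₀) u := by
      rw [hwt_eq, hd_eq, hRreal, div_le_iff₀ (by positivity)]
      have h2n : y ≤ 2 * (n : ℝ) := by linarith
      have : 2 * C / ↑R₀ * (8 * ↑k * ↑R₀ * η / (8 * η * ↑k * y)) = 2 * C / y := by
        field_simp
      rw [this, div_mul_eq_mul_div, le_div_iff₀ (by linarith)]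
      have hkn : C * y ≤ C * (2 * n) := mul_le_mul_of_nonneg_left h2n hC
      nlinarith [mul_nonneg hC hnpos.le, hk1]
    calc |κ₂ s * Tρ k m F η (γ s) u - κ₁ s * Tc k m F η (γ s) u|
        ≤ C / R * Q := key
      _ ≤ (2 * C / R₀) * wt k m F η (8 * k * R₀) u * Q := by
          gcongr
      _ ≤ (2 * K * (2 + 2 * (k : ℝ) ^ 2) + 2 * C / R₀) * (wt k m F η (8 * k * R₀) u * Q) := by
          have : 0 ≤ 2 * K * (2 + 2 * (k : ℝ) ^ 2) * (wt k m F η (8 * k * R₀) u * Q) := by positivity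
          nlinarith
  · -- contact block: trivial bound, weight `1`
    have hylt : y < R₀ := lt_of_not_ge hfar
    have hdle : d ≤ 8 * k * R₀ * η := by
      rw [hd_eq]
      have := mul_lt_mul_of_pos_left hylt (show (0 : ℝ) < 8 * η * k by positivity)
      nlinarith
    have hwt1 : wt k m F η (8 * k * R₀) u = 1 :=
      wt_eq_one_of_le k m F hη hr (by rw [← hd]; exact hdle)
    rw [hwt1, one_mul]
    have h1 : |κ₂ s * Tρ k m F η (γ s) u - κ₁ s * Tc k m F η (γ s) u| ≤
        K * (|Tρ k m F η (γ s) u| + |Tc k m F η (γ s) u|) := by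
      calc |κ₂ s * Tρ k m F η (γ s) u - κ₁ s * Tc k m F η (γ s) u|
          ≤ |κ₂ s * Tρ k m F η (γ s) u| + |κ₁ s * Tc k m F η (γ s) u| := abs_sub _ _
        _ = |κ₂ s| * |Tρ k m F η (γ s) u| + |κ₁ s| * |Tc k m F η (γ s) u| := by rw [abs_mul, abs_mul]
        _ ≤ K * |Tρ k m F η (γ s) u| + K * |Tc k m F η (γ s) u| := by
            gcongr
            · exact hK₂ s
            · exact hK₁ s
        _ = K * (|Tρ k m F η (γ s) u| + |Tc k m F η (γ s) u|) := by ring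
    have h2 := abs_Tρ_add_abs_Tc_le_Piv k m F η (γ s) u
    have h3 : K * (|Tρ k m F η (γ s) u| + |Tc k m F η (γ s) u|) ≤ K * ((2 + 2 * (k : ℝ) ^ 2) * Q) :=
      mul_le_mul_of_nonneg_left (h2.trans hPivQ) hK
    have h4 : K * ((2 + 2 * (k : ℝ) ^ 2) * Q) ≤ (2 * K * (2 + 2 * (k : ℝ) ^ 2) + 2 * C / R₀) * Q := by
      have : 0 ≤ (K * (2 + 2 * (k : ℝ) ^ 2) + 2 * C / R₀) * Q := by positivity
      nlinarith
    linarith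

/-! ### §5c The crux -/

/-- **`TrivialSectorRate_of`** — the registered stubs (block alignment = the engine, boundary relevance
OPEN; Russo–orbit, four arms, far-field factorisation PROVED) imply the crux BY NAME; the PROVED stubs
and the proved mass theorem are discharged inside or passed by name.  For `k`, an RSW path `γ` and a
quad family `F`: the engine gives `κ, C_E, R₀`; bound `|κ|` by `K` on the compact parameter interval; take
the relevance mass data `(a, C_M, η_M)` at contact radius `8kR₀` (`weightedRelevanceMass_of_factorisation`);
then `θ := a`, `η₀ := η_M`, and at every `(s, η)` Russo–orbit gives
`κ₂∂ρP − κ₁∂cP = Σ_u (κ₂Tρ(u) − κ₁Tc(u))` over a finite block set, each term bounded by `perBlockR`;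
summing, `|κ₂∂ρP − κ₁∂cP| ≤ (2K(2+2k²) + 2C_E/R₀)·C_M η^a`. -/
theorem TrivialSectorRate_of (h2 : Registered.stub_blockAlignment) (hB : Registered.stub_boundaryRelevance) :
    Summit.CriticalPhenomena.CardyFormulaZ2.Theses.CardySelfRefinement.TrivialSectorRate := by
  -- the PROVED stubs
  have h1 : Registered.stub_russoOrbit := stub_russoOrbit
  have h3 : Registered.stub_fourArmAboveOne := stub_fourArmAboveOne
  have hT : Registered.stub_farFieldFactorisation := stub_farFieldFactorisation
  rw [trivialSectorRate_iff]
  intro k hk γ hγ m F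
  have hk0 : 0 < k := by rcases hk with rfl | rfl <;> norm_num
  -- the engine
  obtain ⟨κ₁, κ₂, hκ₁, hκ₂, hnv, C, R₀, hC, hR₀, hE⟩ := h2 k hk γ hγ
  -- a uniform bound on `|κ₁|, |κ₂|` over the compact parameter interval
  obtain ⟨K₁, hK₁⟩ := isCompact_univ.exists_bound_of_continuousOn (hκ₁.continuousOn (s := Set.univ))
  obtain ⟨K₂, hK₂⟩ := isCompact_univ.exists_bound_of_continuousOn (hκ₂.continuousOn (s := Set.univ))
  set K : ℝ := max (max K₁ K₂) 0 with hKdef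
  have hK0 : 0 ≤ K := le_max_right _ _
  have hK₁' : ∀ s, |κ₁ s| ≤ K := fun s =>
    le_trans (by simpa [Real.norm_eq_abs] using hK₁ s (Set.mem_univ s)) (le_trans (le_max_left _ _) (le_max_left _ _))
  have hK₂' : ∀ s, |κ₂ s| ≤ K := fun s =>
    le_trans (by simpa [Real.norm_eq_abs] using hK₂ s (Set.mem_univ s)) (le_trans (le_max_right _ _) (le_max_left _ _))
  -- mass data at contact radius `8kR₀`
  have hR₀' : (1 : ℝ) ≤ R₀ := by exact_mod_cast hR₀
  have hkpos : (0 : ℝ) < k := by exact_mod_cast hk0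
  have hr : (0 : ℝ) < 8 * k * R₀ := by positivity
  obtain ⟨a, CM, ηM, ha, hCM, hηM, hMass⟩ :=
    weightedRelevanceMass_of_factorisation hk0 (h3 k hk γ hγ) (hB k hk γ hγ m F) (hT k hk γ m F)
      (8 * k * R₀) hr
  -- the answer
  set A : ℝ := 2 * K * (2 + 2 * (k : ℝ) ^ 2) + 2 * C / R₀ with hAdef
  have hA0 : 0 ≤ A := by positivity
  refine ⟨a, ha, κ₁, κ₂, hκ₁, hκ₂, hnv, A * CM, ηM, hηM, ?_⟩
  intro s η hη
  have hη0 : 0 < η := hη.1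
  -- Russo–orbit at the parameter point `γ s ∈ [0,1]²`
  have hq : γ s ∈ Set.Icc (0 : ℝ) 1 ×ˢ Set.Icc (0 : ℝ) 1 := hγ.2.2.2.1 s
  obtain ⟨U, hUρ, hUc⟩ := h1 k hk (γ s) hq η hη0 m F
  have hsum : κ₂ s * Dρ k m F η (γ s) - κ₁ s * Dc k m F η (γ s) =
      ∑ u ∈ U, (κ₂ s * Tρ k m F η (γ s) u - κ₁ s * Tc k m F η (γ s) u) := by
    rw [hUρ, hUc, Finset.mul_sum, Finset.mul_sum, ← Finset.sum_sub_distrib]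
  rw [hsum]
  -- per-block bounds, summed
  have hblock := fun u => perBlockR (k := k) (γ := γ) hk0 hC hK0 hK₁' hK₂' hR₀ hE s hη0 m F u
  have hle := (Finset.abs_sum_le_sum_abs _ U).trans (Finset.sum_le_sum fun u _ => hblock u)
  rw [← Finset.mul_sum] at hle
  -- the mass bound
  have hM := hMass s η hη U
  have hA : A * ∑ u ∈ U, wt k m F η (8 * k * R₀) u * (M k (γ s).1 (γ s).2).real (Rel k m F η u k) ≤
      A * (CM * η ^ a) := mul_le_mul_of_nonneg_left hM hA0
  calc |∑ u ∈ U, (κ₂ s * Tρ k m F η (γ s) u - κ₁ s * Tc k m F η (γ s) u)|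
      ≤ A * ∑ u ∈ U, wt k m F η (8 * k * R₀) u * (M k (γ s).1 (γ s).2).real (Rel k m F η u k) := hle
    _ ≤ A * (CM * η ^ a) := hA
    _ = (A * CM) * η ^ a := by ring

/-- Wiring check: the registered stubs feed `TrivialSectorRate_of` as stated (the verbatim restatements
are definitionally the named statements). -/
example : Summit.CriticalPhenomena.CardyFormulaZ2.Theses.CardySelfRefinement.TrivialSectorRate :=
  TrivialSectorRate_of stub_blockAlignment stub_boundaryRelevance

/-- Wiring check (sufficient condition): the conditioned local engine also closes the crux, through the
proved glue. -/
example (hL : LocalEngine) (hB : BoundaryRelevance) :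
    Summit.CriticalPhenomena.CardyFormulaZ2.Theses.CardySelfRefinement.TrivialSectorRate :=
  TrivialSectorRate_of (blockAlignment_of_localEngine hL) hB

end Summit.CriticalPhenomena.CardyFormulaZ2.Cruxes.TrivialSectorRate.FarFieldIsAQuarterTurn

end
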